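import Summits.Ventures.PercRepro.RankLevelSetLevelEightCellMult4A

/-!
# PercRepro — THE LEVEL-`8` CELL MAP IN THE KERNEL: THE `e`-FREE CORE AT CORANK `d` CLOSES FROM `p ≥ mult4Thr8 d` (p9, S4)

`proofs/SUBCLAIM-S4-p9.md` §S4.3‴. The `176` inequalities of `RankLevelSetLevelEightArithMult4A … O` are stated at their
per-corank least thresholds (under the closed-form row bound of the fibre sums), so the table `mult4Thr8` (those
thresholds, raised to the tail's `2d + 29` where it is larger: 0 coranks) and the dispatcher
`level_8_poly_mult4_cell` give the cell map at level `8` as a kernel theorem: `c025_core_eight_cell_mult4` — the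
`e`-free core of rank `p` and corank `9 ≤ d ≤ 184` satisfies C-025 at `(p, 8)` whenever `p ≥ mult4Thr8 d`. With
`c025_core_eight_beyond_one_eighty_four` (corank `≥ 185`, `p ≥ 258`) the OPEN part of the `q = 8` window is the band
`{(p, d) : 9 ≤ d ≤ 184, p < mult4Thr8 d} ∪ {(p, d) : d ≥ 185, p ≤ 257}`. Axioms: standard.
-/

open scoped Matroid

namespace PercRepro

namespace ThmN

open Set

variable {α : Type}

/-- **THE LEVEL-`8` CELL MAP IN THE KERNEL**: the `e`-free core of rank `p` and corank `9 ≤ d ≤ 184` satisfies C-025 at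
level `8` as soon as `p ≥ mult4Thr8 d` (the per-corank threshold of the level-8 chain; the (Y) side uses the cap too,
`K = 8 + d`). -/
theorem c025_core_eight_cell_mult4 (M : Matroid α) [M.Finite] (p d : ℕ) (hp : mult4Thr8 d ≤ p) (hd9 : 9 ≤ d)
    (hd184 : d ≤ 184) (hR : M.eRank = (p : ℕ∞)) (hn : M.E.ncard = p + d)
    (hfree : ∀ e ∈ M.E, ∃ A ⊆ M.E \ {e}, e ∉ M.closure A ∧ e ∉ M.closure ((M.E \ {e}) \ A)) :
    RLS M p 8 := by
  classical
  have hEcard : M.ground_finite.toFinset.card = p + d := by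
    rw [← Set.ncard_eq_toFinset_card _ M.ground_finite]; exact hn
  -- the core is simple: every circuit has `≥ 3` elements
  have hL : ∀ e ∈ M.E, ¬ M.IsLoop e := not_isLoop_of_free M hfree
  have hs : ∀ e ∈ M.E, ∀ f ∈ M.E, e ≠ f → M.eRk {e, f} = 2 := by
    intro e he f hf hef
    have h2 : (2 : ℕ∞) ≤ M.eRk {e, f} :=
      two_le_eRk_of_two_le_ncard_of_free M hfree (pair_subset he hf) (by rw [ncard_pair hef])
    have h3 : M.eRk {e, f} ≤ 2 := by
      have := M.eRk_le_encard {e, f}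
      rwa [encard_pair hef] at this
    exact le_antisymm h3 h2
  have hcirc : ∀ C, M.IsCircuit C → 3 ≤ C.encard := three_le_encard_of_circuit M hL hs
  have hd : M.E.encard = M.eRank + d := by
    rw [hR, ← M.ground_finite.cast_ncard_eq, hn]
    push_cast
    ring
  -- the nullity cap: every `X ⊆ E` has `|X| ≤ r(X) + d`
  have hcap : ∀ X ⊆ M.E, ∀ k : ℕ, M.eRk X ≤ k → X.ncard ≤ k + d := by
    intro X hX k hr
    have h1 := Matroid.encard_le_eRk_add_of_encard_eq hX hd
    have h2 : X.encard ≤ (k : ℕ∞) + d := h1.trans (by gcongr)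
    have hfin : X.Finite := M.ground_finite.subset hX
    rw [← hfin.cast_ncard_eq] at h2
    exact_mod_cast h2
  -- rank-`≤ 8` sets have `≤ min 175 (8 + d)` points, rank-`≤ 7` sets `≤ min 87 (7 + d)`
  have hflat : ∀ X ⊆ M.E, M.eRk X ≤ 8 → X.ncard ≤ min 175 (8 + d) :=
    fun X hX hr => le_min (Explicit.ncard_le_one_seventy_five_of_free M hfree X hX hr) (hcap X hX 8 hr)
  have hflat' : ∀ X ⊆ M.E, M.eRk X ≤ ((8 - 1 : ℕ) : ℕ∞) → X.ncard ≤ min 87 (7 + d) :=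
    fun X hX hr => le_min (Explicit.ncard_le_eightyseven_of_free M hfree X hX (by simpa using hr))
      (hcap X hX 7 (by simpa using hr))
  -- (U)
  have hU1 := Matroid.topCount_le_ncard_compl (M := M) hR hd 8
  have hsum := Matroid.ncard_eRk_eq_ncard_le_le_sum (M := M) 8 d
  have hmul := fun m => Matroid.ncard_eRk_eq_ncard_eq_mul_le M 8 (min 175 (8 + d)) (min 87 (7 + d))
    (by norm_num) hcirc hflat hflat' hd m
  have hC1 : ∀ L ⊆ M.E, M.eRk L = 2 → L.ncard ≤ 3 :=
    fun L hL hr => ncard_le_three_of_eRk_two M hs hfree hL hr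
  have hs3 : {C | M.IsCircuit C ∧ C.ncard = 3}.ncard ≤ d * (d + 1) / 2 := by
    have hT : 2 * {C | M.IsCircuit C ∧ C.ncard = 3}.ncard ≤ d * (d + 1) := S1.two_mul_ncard_triangles_le M hC1 hd
    omega
  have hC2 : ∀ P ⊆ M.E, M.eRk P ≤ 3 → P.ncard ≤ 6 :=
    fun P hP hr => ncard_le_six_of_eRk_le_three_of_free M hfree hP hr
  have hC1' : ∀ L ⊆ M.E, M.eRk L ≤ 2 → L.ncard ≤ 3 := by
    intro L hL' hr
    have := ncard_add_one_le_two_pow_of_eRk_le M hL hfree 2 L hL' hr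
    omega
  have hs4 : {C | M.IsCircuit C ∧ C.ncard = 4}.ncard ≤ d * (d + 1) * (d + 2) / 3 := by
    have hT4 : 3 * {C : Set α | M.IsCircuit C ∧ C.ncard = 4}.ncard ≤ d * (d + 1) * (d + 2) :=
      S1.three_mul_ncard_four_circuits_le M hC1' hC2 hd
    omega
  have hs5 : {C | M.IsCircuit C ∧ C.ncard = 5}.ncard ≤ (d + 4).choose 5 :=
    Matroid.ncard_circuits_le_choose_of_encard M hd 4
  have hs6 : {C | M.IsCircuit C ∧ C.ncard = 6}.ncard ≤ (d + 5).choose 6 :=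
    Matroid.ncard_circuits_le_choose_of_encard M hd 5
  have hs7 : {C | M.IsCircuit C ∧ C.ncard = 7}.ncard ≤ (d + 6).choose 7 :=
    Matroid.ncard_circuits_le_choose_of_encard M hd 6
  have hs8 : {C | M.IsCircuit C ∧ C.ncard = 8}.ncard ≤ (d + 7).choose 8 :=
    Matroid.ncard_circuits_le_choose_of_encard M hd 7
  have hs9 : {C | M.IsCircuit C ∧ C.ncard = 9}.ncard ≤ (d + 8).choose 9 :=
    Matroid.ncard_circuits_le_choose_of_encard M hd 8
  -- the two pair sums, bounded
  set A : ℕ := ∑ k ∈ Finset.Icc 3 (8 + 1), {C | M.IsCircuit C ∧ C.ncard = k}.ncard * M.E.ncard.choose (8 + 1 - k)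
    with hAdef
  set B : ℕ := ∑ k ∈ Finset.Icc 3 (8 + 1), {C | M.IsCircuit C ∧ C.ncard = k}.ncard * ((8 + 1) * d).choose (8 + 1 - k)
    with hBdef
  have hA : A ≤ d * (d + 1) / 2 * (p + d).choose 6 + d * (d + 1) * (d + 2) / 3 * (p + d).choose 5 + (d + 4).choose 5 * (p + d).choose 4 + (d + 5).choose 6 * (p + d).choose 3 + (d + 6).choose 7 * (p + d).choose 2 + (d + 7).choose 8 * (p + d) + (d + 8).choose 9 := by
    rw [hAdef, Explicit.sum_Icc_three_nine, hn]
    simp only [show (8 : ℕ) + 1 - 3 = 6 from rfl, show (8 : ℕ) + 1 - 4 = 5 from rfl,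
      show (8 : ℕ) + 1 - 5 = 4 from rfl, show (8 : ℕ) + 1 - 6 = 3 from rfl,
      show (8 : ℕ) + 1 - 7 = 2 from rfl, show (8 : ℕ) + 1 - 8 = 1 from rfl, show (8 : ℕ) + 1 - 9 = 0 from rfl,
      Nat.choose_one_right, Nat.choose_zero_right, mul_one]
    gcongr
  have hB : B ≤ d * (d + 1) / 2 * (9 * d).choose 6 + d * (d + 1) * (d + 2) / 3 * (9 * d).choose 5 + (d + 4).choose 5 * (9 * d).choose 4 + (d + 5).choose 6 * (9 * d).choose 3 + (d + 6).choose 7 * (9 * d).choose 2 + (d + 7).choose 8 * (9 * d) + (d + 8).choose 9 := by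
    rw [hBdef, Explicit.sum_Icc_three_nine]
    simp only [show (8 : ℕ) + 1 - 3 = 6 from rfl, show (8 : ℕ) + 1 - 4 = 5 from rfl,
      show (8 : ℕ) + 1 - 5 = 4 from rfl, show (8 : ℕ) + 1 - 6 = 3 from rfl,
      show (8 : ℕ) + 1 - 7 = 2 from rfl, show (8 : ℕ) + 1 - 8 = 1 from rfl, show (8 : ℕ) + 1 - 9 = 0 from rfl,
      Nat.choose_one_right, Nat.choose_zero_right, mul_one, show (8 : ℕ) + 1 = 9 from rfl]
    gcongr
  -- the level counts in `ℚ`, weighted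
  have hlevel : ∀ m ∈ Finset.Icc 9 d, ({X : Set α | X ⊆ M.E ∧ M.eRk X = 8 ∧ X.ncard = m}.ncard : ℚ) ≤
      (((min 87 (7 + d) - 8).choose (m - 9) : ℚ) * (A : ℚ) + ((min 175 (8 + d) - 9).choose (m - 9) : ℚ) * (B : ℚ)) /
        ((m - 8 : ℕ) : ℚ) := by
    intro m hm
    rw [Finset.mem_Icc] at hm
    have hpos : (0 : ℚ) < ((m - 8 : ℕ) : ℚ) := by exact_mod_cast (by omega : 0 < m - 8)
    rw [le_div_iff₀ hpos]
    have h := hmul m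
    simp only [show (8 : ℕ) + 1 = 9 from rfl] at h
    have h' : (((m - 8) * {X : Set α | X ⊆ M.E ∧ M.eRk X = 8 ∧ X.ncard = m}.ncard : ℕ) : ℚ) ≤
        (((min 87 (7 + d) - 8).choose (m - 9) * A + (min 175 (8 + d) - 9).choose (m - 9) * B : ℕ) : ℚ) := by
      exact_mod_cast h
    push_cast at h'
    linarith
  have hre : ∑ m ∈ Finset.Icc 9 d,
      (((min 87 (7 + d) - 8).choose (m - 9) : ℚ) * (A : ℚ) + ((min 175 (8 + d) - 9).choose (m - 9) : ℚ) * (B : ℚ)) /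
        ((m - 8 : ℕ) : ℚ) =
      ∑ j ∈ Finset.range (d - 8),
      (((min 87 (7 + d) - 8).choose j : ℚ) * (A : ℚ) + ((min 175 (8 + d) - 9).choose j : ℚ) * (B : ℚ)) / ((j : ℚ) + 1) := by
    rw [show Finset.Icc 9 d = Finset.image (fun j => 9 + j) (Finset.range (d - 8)) from ?_]
    · rw [Finset.sum_image (fun a _ b _ h => by omega)]
      apply Finset.sum_congr rfl
      intro j _
      rw [show 9 + j - 9 = j by omega, show 9 + j - 8 = j + 1 by omega]
      push_cast
      ring
    · ext m
      rw [Finset.mem_Icc, Finset.mem_image]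
      constructor
      · intro hm
        exact ⟨m - 9, by rw [Finset.mem_range]; omega, by omega⟩
      · rintro ⟨j, hj, rfl⟩
        rw [Finset.mem_range] at hj
        omega
  have hrange : Finset.range (d - 8) ⊆ Finset.range (d - 9 + 1) := Finset.range_mono (by omega)
  have hUq : (Matroid.topCount M p 8 : ℚ) ≤ ((p + d).choose 8 : ℚ) +
      ((∑ j ∈ Finset.range (d - 9 + 1), ((Nat.choose (min 87 (7 + d) - 8) j : ℕ) : ℚ) / ((j : ℚ) + 1)) * (((d * (d + 1) / 2 : ℕ) : ℚ) * ((p + d).choose 6 : ℚ) + ((d * (d + 1) * (d + 2) / 3 : ℕ) : ℚ) * ((p + d).choose 5 : ℚ) + (((d + 4).choose 5 : ℕ) : ℚ) * ((p + d).choose 4 : ℚ) + (((d + 5).choose 6 : ℕ) : ℚ) * ((p + d).choose 3 : ℚ) + (((d + 6).choose 7 : ℕ) : ℚ) * ((p + d).choose 2 : ℚ) + (((d + 7).choose 8 : ℕ) : ℚ) * (p + d : ℚ) + (((d + 8).choose 9 : ℕ) : ℚ)) + (∑ j ∈ Finset.range (d - 9 + 1), ((Nat.choose (min 175 (8 + d)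 - 9) j : ℕ) : ℚ) / ((j : ℚ) + 1)) * (((d * (d + 1) / 2 : ℕ) : ℚ) * ((9 * d).choose 6 : ℚ) + ((d * (d + 1) * (d + 2) / 3 : ℕ) : ℚ) * ((9 * d).choose 5 : ℚ) + (((d + 4).choose 5 : ℕ) : ℚ) * ((9 * d).choose 4 : ℚ) + (((d + 5).choose 6 : ℕ) : ℚ) * ((9 * d).choose 3 : ℚ) + (((d + 6).choose 7 : ℕ) : ℚ) * ((9 * d).choose 2 : ℚ) + (((d + 7).choose 8 : ℕ) : ℚ) * (9 * d : ℚ) + (((d + 8).choose 9 : ℕ) : ℚ))) := by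
    have h1 : (Matroid.topCount M p 8 : ℚ) ≤ ((p + d).choose 8 : ℚ) +
        ∑ m ∈ Finset.Icc 9 d, ({X : Set α | X ⊆ M.E ∧ M.eRk X = 8 ∧ X.ncard = m}.ncard : ℚ) := by
      have := hU1.trans hsum
      rw [hn] at this
      simp only [show (8 : ℕ) + 1 = 9 from rfl] at this
      exact_mod_cast this
    have hAq : (A : ℚ) ≤ (((d * (d + 1) / 2 : ℕ) : ℚ) * ((p + d).choose 6 : ℚ) + ((d * (d + 1) * (d + 2) / 3 : ℕ) : ℚ) * ((p + d).choose 5 : ℚ) + (((d + 4).choose 5 : ℕ) : ℚ) * ((p + d).choose 4 : ℚ) + (((d + 5).choose 6 : ℕ) : ℚ) * ((p + d).choose 3 : ℚ) + (((d + 6).choose 7 : ℕ) : ℚ) * ((p + d).choose 2 : ℚ) + (((d + 7).choose 8 : ℕ) : ℚ) * (p + d : ℚ) + (((d + 8).choose 9 : ℕ) : ℚ)) := by exact_mod_cast hA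
    have hBq : (B : ℚ) ≤ (((d * (d + 1) / 2 : ℕ) : ℚ) * ((9 * d).choose 6 : ℚ) + ((d * (d + 1) * (d + 2) / 3 : ℕ) : ℚ) * ((9 * d).choose 5 : ℚ) + (((d + 4).choose 5 : ℕ) : ℚ) * ((9 * d).choose 4 : ℚ) + (((d + 5).choose 6 : ℕ) : ℚ) * ((9 * d).choose 3 : ℚ) + (((d + 6).choose 7 : ℕ) : ℚ) * ((9 * d).choose 2 : ℚ) + (((d + 7).choose 8 : ℕ) : ℚ) * (9 * d : ℚ) + (((d + 8).choose 9 : ℕ) : ℚ)) := by exact_mod_cast hB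
    have hσs0 : (0 : ℚ) ≤ (∑ j ∈ Finset.range (d - 9 + 1), ((Nat.choose (min 87 (7 + d) - 8) j : ℕ) : ℚ) / ((j : ℚ) + 1)) :=
      Finset.sum_nonneg (fun j _ => by positivity)
    have hσ0 : (0 : ℚ) ≤ (∑ j ∈ Finset.range (d - 9 + 1), ((Nat.choose (min 175 (8 + d) - 9) j : ℕ) : ℚ) / ((j : ℚ) + 1)) :=
      Finset.sum_nonneg (fun j _ => by positivity)
    have h2 : ∑ m ∈ Finset.Icc 9 d, ({X : Set α | X ⊆ M.E ∧ M.eRk X = 8 ∧ X.ncard = m}.ncard : ℚ) ≤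
        (∑ j ∈ Finset.range (d - 9 + 1), ((Nat.choose (min 87 (7 + d) - 8) j : ℕ) : ℚ) / ((j : ℚ) + 1)) * (A : ℚ) + (∑ j ∈ Finset.range (d - 9 + 1), ((Nat.choose (min 175 (8 + d) - 9) j : ℕ) : ℚ) / ((j : ℚ) + 1)) * (B : ℚ) := by
      rw [Finset.sum_mul, Finset.sum_mul, ← Finset.sum_add_distrib]
      refine (Finset.sum_le_sum hlevel).trans (hre.le.trans ?_)
      refine Finset.sum_le_sum_of_subset_of_nonneg hrange (fun j _ _ => by positivity) |>.trans' ?_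
      apply le_of_eq
      apply Finset.sum_congr rfl
      intro j _
      field_simp
    have e1 := mul_le_mul_of_nonneg_left hAq hσs0
    have e2 := mul_le_mul_of_nonneg_left hBq hσ0
    linarith
  -- (Y), with the cap: rank-`≤ 8` sets have `≤ 8 + d` points
  have hp2 : 2 * d + 29 ≤ p := by
    have := mult4Thr8_ge d hd9 hd184
    omega
  have hY := Matroid.two_pow_le_midCount_add (M := M) p 8 hR
  have hA : {X : Set α | X ⊆ M.E ∧ M.eRk X ≤ 8}.ncard ≤ ∑ j ∈ Finset.range (8 + d + 1), (p + d).choose j := by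
    calc {X : Set α | X ⊆ M.E ∧ M.eRk X ≤ 8}.ncard
        ≤ {X : Set α | X ⊆ (M.ground_finite.toFinset : Set α) ∧ X.ncard ≤ 8 + d}.ncard := by
          apply ncard_le_ncard
          · intro X hX
            exact ⟨by rw [Set.Finite.coe_toFinset]; exact hX.1, (hflat X hX.1 hX.2).trans (min_le_right _ _)⟩
          · exact (Finset.finite_toSet _).finite_subsets.subset (fun X hX => hX.1)
      _ ≤ ∑ j ∈ Finset.range (8 + d + 1), M.ground_finite.toFinset.card.choose j :=
          ncard_subsets_ncard_le _ (8 + d)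
      _ = ∑ j ∈ Finset.range (8 + d + 1), (p + d).choose j := by rw [hEcard]
  have hB := Matroid.ncard_spanning_le (M := M) hd
  rw [hEcard] at hY hB
  -- the tails: `16·Σ_{j ≤ 8 + d} C(n, j) ≤ 2^n` for `n ≥ 3(8 + d) + 5`
  have hT : 16 * ∑ j ∈ Finset.range (8 + d + 1), (p + d).choose j ≤ 2 ^ (p + d) :=
    Explicit.sixteen_mul_sum_range_choose_le (8 + d) (p + d) (by omega)
  have hB' : ∑ j ∈ Finset.range (d + 1), (p + d).choose j ≤ ∑ j ∈ Finset.range (8 + d + 1), (p + d).choose j :=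
    Finset.sum_le_sum_of_subset_of_nonneg (Finset.range_mono (by omega)) (fun _ _ _ => Nat.zero_le _)
  have hAB : 8 * ({X : Set α | X ⊆ M.E ∧ M.eRk X ≤ 8}.ncard +
      {X : Set α | X ⊆ M.E ∧ M.eRk X = M.eRank}.ncard) ≤ 2 ^ (p + d) := by
    have h2 := hB.trans hB'
    omega
  -- (Φ) and the polynomial inequality
  have hΦ := phiK_le_two_pow_div p 8
  rw [Nat.choose_symm_add] at hΦ
  have hpolyq := level_8_poly_mult4_cell d hd9 hd184 p hp
  rw [add_assoc] at hpolyq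
  -- assemble in `ℚ`
  rw [RLS_iff]
  have hYq : (2 : ℚ) ^ (p + d) ≤ (Matroid.midCount M p 8 : ℚ) +
      ({X : Set α | X ⊆ M.E ∧ M.eRk X ≤ 8}.ncard : ℚ) +
      ({X : Set α | X ⊆ M.E ∧ M.eRk X = M.eRank}.ncard : ℚ) := by exact_mod_cast hY
  have hABq : 8 * (({X : Set α | X ⊆ M.E ∧ M.eRk X ≤ 8}.ncard : ℚ) +
      ({X : Set α | X ⊆ M.E ∧ M.eRk X = M.eRank}.ncard : ℚ)) ≤ 2 ^ (p + d) := by exact_mod_cast hAB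
  have hU0 : (0 : ℚ) ≤ (Matroid.topCount M p 8 : ℚ) := Nat.cast_nonneg _
  have hd8 : 8 ≤ d := by omega
  exact level_arith (p := p) (d := d) (n := p + d) (q := 8) rfl hd8 hΦ hU0 hUq hYq hABq hpolyq


end ThmN

end PercRepro
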